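import Literature.MathematicalPhysics.QuantumFieldTheory.OSLabelledTower
import Literature.Analysis.Complex.ArgRegionMaxPrinciple
import Mathlib.Analysis.MeanInequalities
import HarnessLib

/-!
# The temperedness induction of OS II, Ch. VI.2: the regularised functions and one step of (6.28)

Topic `Literature/MathematicalPhysics/QuantumFieldTheory`; support file (all proved; the
regularisation data as definitions; no named facts) for the discharge of (A1)
`OS1975_exists_timeContinuation`. Osterwalder–Schrader II (Comm. Math. Phys. 42 (1975)), Ch. VI.2,
(6.21)–(6.29): the bound (6.28) on the **regularised functions** (6.21)
`S_{k,ε}(ζ) = [k⁻¹ ∑ ζᵢ + ε⁻¹]^{-kt} S_k(ζ + ε⃗)` is propagated from level `N` to level `N + 1` by the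
Schwarz inequality (6.22) for `S_k`, turned into the Schwarz inequality (6.23) for `S_{k,ε}` by the
comparison (6.24)–(6.27) of the weights at the argument and at the two Gram points (*"(6.27) follows
from the convexity of the function −ln x"*: weighted AM–GM, exact), and by the maximum principle
(6.15) on the envelope of holomorphy `C_k^{(M+1)}` of the generating regions — here the growth-free
form `Literature.Analysis.Complex.norm_le_of_norm_le_on_argRegion`. In the variables and regions of
`OSEnvelopeBases`/`OSLabelledTower`:

* `shiftVec ε Z = Z + ε⃗`, `osW k ε Z = ε⁻¹ + k⁻¹ ∑ Zᵢ`, `osWeight k ε T Z = (osW k ε Z)⁻¹^{kT}`,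
  `regFun Sext ε T k c Z = osWeight k ε T Z · Sext k c (Z + ε⃗)` — (6.21);
* `sum_cPlace`, `osW_gram`, `norm_osWeight_gram`, `norm_osWeight_le` — the weights at the Gram points
  `(L, t, L̄)` are real, and `|osW| ≥ Re osW`;
* `pow_mul_pow_le_of_amgm` — weighted AM–GM `Xʳ Yˢ ≤ ((rX + sY)/(r+s))^{r+s}`, and
  `norm_osWeight_sq_le` — **(6.24)–(6.27)**: `|ω_k(Z)|² ≤ |ω_{2p+1}(GL⁰)| |ω_{2q+1}(GR⁰)|` for the Gram
  points with middle entry `Re Z_p/2`;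
* `tempered_step` — **one step of (6.28)/(6.29)**: if `‖regFun k c‖ ≤ B k` on the regions of
  `c_k^{(n+1)}` for all `k` and the good labels, and `CT √(B_{2p+1} B_{2q+1}) ≤ B' k`, then
  `‖regFun k c‖ ≤ max (B k) (B' k)` on the regions of `c_k^{(n+2)}` — from the level-free Schwarz
  inequality of the tower (`OSLabelledTower`) at the shifted point, the weight comparison, and the
  growth-free maximum principle over the base `stepBase n k` of the step.

## References

* K. Osterwalder, R. Schrader, *Axioms for Euclidean Green's functions II*, Comm. Math. Phys.
  42 (1975) 281–305, Ch. VI.2 (6.15), (6.21)–(6.29). [OsterwalderSchraderCMP1975]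
-/

noncomputable section

open Metric Set Filter Complex
open scoped Topology ComplexConjugate InnerProductSpace Pointwise BigOperators

namespace Literature.MathematicalPhysics.QuantumFieldTheory.OSEnvelope

open Literature.Analysis.Complex Literature.MathematicalPhysics.QuantumFieldTheory

variable {E : Type*}

/-! ### Sums over placements and blocks -/

/-- **The sum of the entries of a placement.** [folklore] -/
theorem sum_cPlace {α : Type*} [AddCommMonoid α] {m₁ m₂ : ℕ} (w : Fin m₁ → α) (t : α) (z : Fin m₂ → α) :
    ∑ i, cPlace w t z i = ∑ j, w j + t + ∑ j, z j := by
  rw [Fin.sum_univ_add, Fin.sum_univ_castSucc]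
  have h1 : ∀ i : Fin m₁, cPlace w t z (Fin.castAdd m₂ (Fin.castSucc i)) = w (Fin.rev i) := fun i => by
    rw [cPlace_apply_lt _ _ _ (by simp)]
    congr 1; ext; simp [Fin.val_rev]; omega
  have h2 : cPlace w t z (Fin.castAdd m₂ (Fin.last m₁)) = t := cPlace_apply_mid _ _ _ (by simp)
  have h3 : ∀ j : Fin m₂, cPlace w t z (Fin.natAdd (m₁ + 1) j) = z j := fun j => by
    rw [cPlace_apply_gt _ _ _ (by simp; omega)]
    congr 1; ext; simp; omega
  simp only [h1, h2, h3]
  rw [show (∑ i : Fin m₁, w (Fin.rev i)) = ∑ i, w i from Equiv.sum_comp Fin.revPerm w]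

/-- **The sum of the entries of a vector through its blocks** at any position. [folklore] -/
theorem sum_blocks {α : Type*} [AddCommMonoid α] {k : ℕ} (Z : Fin k → α) (p : Fin k) :
    ∑ i, Z i = ∑ j, blockRevLeft Z p j + Z p + ∑ j, blockRight Z p j := by
  have hk : k = p + 1 + (k - 1 - p) := by have := p.2; omega
  rw [← sum_cPlace]
  exact Fintype.sum_equiv (finCongr hk) _ _ fun i => by
    rw [finCongr_apply]
    exact (cPlace_blocks Z p i).symm

/-! ### The shift and the weights (6.21) -/

/-- **The real shift** `Z + ε⃗`. [cite: OsterwalderSchraderCMP1975, Ch. VI.2 (6.21)] -/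
def shiftVec {k : ℕ} (ε : ℝ) (Z : Fin k → ℂ) : Fin k → ℂ := fun i => Z i + ε

/-- Entries of the shift. [folklore] -/
@[simp] theorem shiftVec_apply {k : ℕ} (ε : ℝ) (Z : Fin k → ℂ) (i : Fin k) : shiftVec ε Z i = Z i + ε := rfl

/-- The shift by a nonnegative real preserves `ℂ₊ᵏ`. [folklore] -/
theorem shiftVec_re_pos {k : ℕ} {ε : ℝ} (hε : 0 ≤ ε) {Z : Fin k → ℂ} (hZ : ∀ i, 0 < (Z i).re) (i : Fin k) :
    0 < (shiftVec ε Z i).re := by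
  simp only [shiftVec_apply, Complex.add_re, Complex.ofReal_re]; linarith [hZ i]

/-- The shift is complex-differentiable. [folklore] -/
theorem differentiable_shiftVec {k : ℕ} (ε : ℝ) : Differentiable ℂ (shiftVec (k := k) ε) :=
  differentiable_pi.2 fun i => (differentiable_apply i).add_const _

/-- The reversed left block of the shift is the shift of the block. [folklore] -/
theorem blockRevLeft_shiftVec {k : ℕ} (ε : ℝ) (Z : Fin k → ℂ) (p : Fin k) :
    blockRevLeft (shiftVec ε Z) p = shiftVec ε (blockRevLeft Z p) := rfl

/-- The right block of the shift is the shift of the block. [folklore] -/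
theorem blockRight_shiftVec {k : ℕ} (ε : ℝ) (Z : Fin k → ℂ) (p : Fin k) :
    blockRight (shiftVec ε Z) p = shiftVec ε (blockRight Z p) := rfl

/-- Conjugation commutes with the real shift. [folklore] -/
theorem star_shiftVec {m : ℕ} (ε : ℝ) (w : Fin m → ℂ) : star (shiftVec ε w) = shiftVec ε (star w) := by
  funext i; simp [shiftVec, Pi.star_apply]

/-- **The Gram point of shifted blocks is the shifted Gram point** with the shift removed from the
middle entry. [folklore] -/
theorem cDiagEmbed_shiftVec {m : ℕ} (ε : ℝ) (w : Fin m → ℂ) (t : ℂ) (z : Fin m → ℂ) :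
    cDiagEmbed (shiftVec ε w) (t + ε) (shiftVec ε z) = shiftVec ε (cDiagEmbed w t z) := by
  funext i
  rcases lt_trichotomy (i : ℕ) m with h | h | h
  · rw [cDiagEmbed_apply_lt _ _ _ h, shiftVec_apply, shiftVec_apply, cDiagEmbed_apply_lt _ _ _ h]
  · rw [cDiagEmbed_apply_mid _ _ _ h, shiftVec_apply, cDiagEmbed_apply_mid _ _ _ h]
  · rw [cDiagEmbed_apply_gt _ _ _ h, shiftVec_apply, shiftVec_apply, cDiagEmbed_apply_gt _ _ _ h]

/-- **The base of the weight** `ε⁻¹ + k⁻¹ ∑ᵢ Zᵢ`. [cite: OsterwalderSchraderCMP1975, Ch. VI.2 (6.21)] -/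
def osW (k : ℕ) (ε : ℝ) (Z : Fin k → ℂ) : ℂ := ((ε⁻¹ : ℝ) : ℂ) + (∑ i, Z i) / (k : ℂ)

/-- **The weight** `[ε⁻¹ + k⁻¹ ∑ᵢ Zᵢ]^{-kT}`. [cite: OsterwalderSchraderCMP1975, Ch. VI.2 (6.21)] -/
def osWeight (k : ℕ) (ε : ℝ) (T : ℕ) (Z : Fin k → ℂ) : ℂ := ((osW k ε Z)⁻¹) ^ (k * T)

/-- **The regularised functions (6.21)** `S_{k,ε}(Z) = [ε⁻¹ + k⁻¹ ∑ Zᵢ]^{-kT} S_k(Z + ε⃗)`. [cite: OsterwalderSchraderCMP1975, Ch. VI.2 (6.21)] -/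
def regFun (Sext : (k : ℕ) → (Fin (k + 1) → E) → (Fin k → ℂ) → ℂ) (ε : ℝ) (T : ℕ) (k : ℕ)
    (c : Fin (k + 1) → E) (Z : Fin k → ℂ) : ℂ :=
  osWeight k ε T Z * Sext k c (shiftVec ε Z)

/-- The real part of the base: `ε⁻¹ + k⁻¹ ∑ Re Zᵢ`. [folklore] -/
theorem osW_re {k : ℕ} (ε : ℝ) (Z : Fin k → ℂ) :
    (osW k ε Z).re = ε⁻¹ + (∑ i, (Z i).re) / k := by
  simp only [osW, Complex.add_re, Complex.ofReal_re]
  rw [show ((k : ℂ)) = ((k : ℝ) : ℂ) by simp, Complex.div_ofReal_re, Complex.re_sum]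

/-- The real part of the base is positive on `ℂ₊ᵏ` (`ε > 0`, `k ≥ 1`). [folklore] -/
theorem osW_re_pos {k : ℕ} (hk : 0 < k) {ε : ℝ} (hε : 0 < ε) {Z : Fin k → ℂ} (hZ : ∀ i, 0 < (Z i).re) :
    0 < (osW k ε Z).re := by
  rw [osW_re]
  have h1 : 0 ≤ ∑ i, (Z i).re := Finset.sum_nonneg fun i _ => (hZ i).le
  positivity

/-- The base does not vanish on `ℂ₊ᵏ`. [folklore] -/
theorem osW_ne_zero {k : ℕ} (hk : 0 < k) {ε : ℝ} (hε : 0 < ε) {Z : Fin k → ℂ} (hZ : ∀ i, 0 < (Z i).re) :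
    osW k ε Z ≠ 0 := fun h => by
  have := osW_re_pos hk hε hZ; rw [h] at this; simp at this

/-- The weight does not vanish on `ℂ₊ᵏ`. [folklore] -/
theorem osWeight_ne_zero {k : ℕ} (hk : 0 < k) {ε : ℝ} (hε : 0 < ε) (T : ℕ) {Z : Fin k → ℂ}
    (hZ : ∀ i, 0 < (Z i).re) : osWeight k ε T Z ≠ 0 :=
  pow_ne_zero _ (inv_ne_zero (osW_ne_zero hk hε hZ))

/-- **The weight is holomorphic on `ℂ₊ᵏ`.** [folklore] -/
theorem differentiableOn_osWeight {k : ℕ} (hk : 0 < k) {ε : ℝ} (hε : 0 < ε) (T : ℕ) :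
    DifferentiableOn ℂ (osWeight k ε T) {Z : Fin k → ℂ | ∀ i, 0 < (Z i).re} := by
  have hW : Differentiable ℂ (osW k ε) := by
    unfold osW
    fun_prop
  intro Z hZ
  exact (((hW Z).inv (osW_ne_zero hk hε hZ)).pow _).differentiableWithinAt

/-- **The modulus of the weight through the real part of the base**: on `ℂ₊ᵏ`,
`‖ω_k(Z)‖ ≤ ((ε⁻¹ + k⁻¹ ∑ Re Zᵢ)^{kT})⁻¹`. [cite: OsterwalderSchraderCMP1975, Ch. VI.2 (6.24)] -/
theorem norm_osWeight_le {k : ℕ} (hk : 0 < k) {ε : ℝ} (hε : 0 < ε) (T : ℕ) {Z : Fin k → ℂ}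
    (hZ : ∀ i, 0 < (Z i).re) :
    ‖osWeight k ε T Z‖ ≤ ((ε⁻¹ + (∑ i, (Z i).re) / k) ^ (k * T))⁻¹ := by
  have hre := osW_re_pos hk hε hZ
  rw [osWeight, norm_pow, norm_inv, inv_pow]
  refine inv_anti₀ (pow_pos (by rwa [osW_re] at hre) _) (pow_le_pow_left₀ ?_ ?_ _)
  · rw [← osW_re]; exact hre.le
  · rw [← osW_re]; exact Complex.re_le_norm _

/-- **The base at a Gram point `(L, t, L̄)` is real**: `ε⁻¹ + r⁻¹ (2 ∑ Re Lⱼ + t)` (`r = 2p+1`). [cite: OsterwalderSchraderCMP1975, Ch. VI.2 (6.24)] -/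
theorem osW_gram {m : ℕ} (ε : ℝ) (L : Fin m → ℂ) (t : ℝ) :
    osW (m + 1 + m) ε (cDiagEmbed L (t : ℂ) (star L)) =
      ((ε⁻¹ + (2 * ∑ j, (L j).re + t) / (m + 1 + m : ℕ) : ℝ) : ℂ) := by
  rw [osW, cDiagEmbed_eq_cPlace, sum_cPlace]
  have hsum : ∑ j, L j + (t : ℂ) + ∑ j, (star L) j = ((2 * ∑ j, (L j).re + t : ℝ) : ℂ) := by
    have h1 : ∑ j, L j + ∑ j, (star L) j = ((2 * ∑ j, (L j).re : ℝ) : ℂ) := by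
      rw [← Finset.sum_add_distrib, Complex.ofReal_mul, Complex.ofReal_sum, Finset.mul_sum]
      refine Finset.sum_congr rfl fun j _ => ?_
      rw [Pi.star_apply, Complex.star_def, Complex.add_conj]
      push_cast; ring
    calc ∑ j, L j + (t : ℂ) + ∑ j, (star L) j = (∑ j, L j + ∑ j, (star L) j) + (t : ℂ) := by ring
      _ = ((2 * ∑ j, (L j).re + t : ℝ) : ℂ) := by rw [h1]; push_cast; ring
  rw [hsum]
  push_cast
  ring

/-- **The modulus of the weight at a Gram point** `(L, t, L̄)` with `Re L > 0`, `t > 0`, `ε > 0`: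
`‖ω_r(L, t, L̄)‖ = ((ε⁻¹ + r⁻¹(2 ∑ Re Lⱼ + t))^{rT})⁻¹`. [cite: OsterwalderSchraderCMP1975, Ch. VI.2 (6.24)] -/
theorem norm_osWeight_gram {m : ℕ} {ε : ℝ} (hε : 0 < ε) (T : ℕ) {L : Fin m → ℂ} (hL : ∀ j, 0 < (L j).re)
    {t : ℝ} (ht : 0 < t) :
    ‖osWeight (m + 1 + m) ε T (cDiagEmbed L (t : ℂ) (star L))‖ =
      ((ε⁻¹ + (2 * ∑ j, (L j).re + t) / (m + 1 + m : ℕ)) ^ ((m + 1 + m) * T))⁻¹ := by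
  have hpos : 0 < ε⁻¹ + (2 * ∑ j, (L j).re + t) / (m + 1 + m : ℕ) := by
    have : 0 ≤ ∑ j, (L j).re := Finset.sum_nonneg fun j _ => (hL j).le
    positivity
  rw [osWeight, osW_gram, norm_pow, norm_inv, Complex.norm_real, Real.norm_eq_abs, abs_of_pos hpos, inv_pow]

/-! ### The comparison of the weights (6.24)–(6.27) -/

/-- **Weighted AM–GM with natural exponents**: `Xʳ Yˢ ≤ ((rX + sY)/(r+s))^{r+s}` for `X, Y ≥ 0`,
`r + s > 0` (OS's (6.27), "the convexity of the function `−ln x`"). [cite: OsterwalderSchraderCMP1975, Ch. VI.2 (6.27)] -/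
theorem pow_mul_pow_le_of_amgm {X Y : ℝ} (hX : 0 ≤ X) (hY : 0 ≤ Y) {r s : ℕ} (hrs : 0 < r + s) :
    X ^ r * Y ^ s ≤ ((r * X + s * Y) / (r + s)) ^ (r + s) := by
  have hn : (0 : ℝ) < r + s := by exact_mod_cast hrs
  set w₁ : ℝ := r / (r + s) with hw₁
  set w₂ : ℝ := s / (r + s) with hw₂
  have hw₁0 : 0 ≤ w₁ := by positivity
  have hw₂0 : 0 ≤ w₂ := by positivity
  have hw : w₁ + w₂ = 1 := by rw [hw₁, hw₂, ← add_div, div_self hn.ne']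
  have h := Real.geom_mean_le_arith_mean2_weighted hw₁0 hw₂0 hX hY hw
  -- raise to the power `r + s`
  have hL : 0 ≤ X ^ w₁ * Y ^ w₂ := by positivity
  have h2 := pow_le_pow_left₀ hL h (r + s)
  have hlhs : (X ^ w₁ * Y ^ w₂) ^ (r + s) = X ^ r * Y ^ s := by
    rw [mul_pow, ← Real.rpow_natCast (X ^ w₁), ← Real.rpow_natCast (Y ^ w₂), ← Real.rpow_mul hX,
      ← Real.rpow_mul hY]
    have e1 : w₁ * ((r + s : ℕ) : ℝ) = r := by rw [hw₁]; push_cast; field_simp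
    have e2 : w₂ * ((r + s : ℕ) : ℝ) = s := by rw [hw₂]; push_cast; field_simp
    rw [e1, e2, Real.rpow_natCast, Real.rpow_natCast]
  have hrhs : w₁ * X + w₂ * Y = (r * X + s * Y) / (r + s) := by
    rw [hw₁, hw₂]; field_simp
  rw [hlhs, hrhs] at h2
  exact h2

/-- **The comparison of the weights (6.24)–(6.26)**: for `Z ∈ ℂ₊ᵏ`, a position `p` with blocks
`L = (Z_{p-1}, …, Z_0)`, `R = (Z_{p+1}, …)` and the Gram points `GL⁰ = (L, Re Z_p/2, L̄)`,
`GR⁰ = (R̄, Re Z_p/2, R)`: `‖ω_k(Z)‖² ≤ ‖ω_{2p+1}(GL⁰)‖ ‖ω_{2q+1}(GR⁰)‖`. [cite: OsterwalderSchraderCMP1975, Ch. VI.2 (6.24)–(6.27)] -/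
theorem norm_osWeight_sq_le {k : ℕ} {ε : ℝ} (hε : 0 < ε) (T : ℕ) {Z : Fin k → ℂ} (hZ : ∀ i, 0 < (Z i).re)
    (p : Fin k) :
    ‖osWeight k ε T Z‖ ^ 2 ≤
      ‖osWeight (p + 1 + p) ε T (cDiagEmbed (blockRevLeft Z p) (((Z p).re / 2 : ℝ) : ℂ) (star (blockRevLeft Z p)))‖ *
      ‖osWeight (k - 1 - p + 1 + (k - 1 - p)) ε T
        (cDiagEmbed (star (blockRight Z p)) (((Z p).re / 2 : ℝ) : ℂ) (blockRight Z p))‖ := by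
  have hk : 0 < k := Fin.pos p
  have ht : 0 < (Z p).re / 2 := by have := hZ p; positivity
  have hL : ∀ j, 0 < (blockRevLeft Z p j).re := fun j => hZ _
  have hR' : ∀ j, 0 < ((star (blockRight Z p)) j).re := fun j => by
    simp only [Pi.star_apply, Complex.star_def, Complex.conj_re]; exact hZ _
  -- the right Gram point is `(W, t, W̄)` with `W = R̄`
  have hright : cDiagEmbed (star (blockRight Z p)) (((Z p).re / 2 : ℝ) : ℂ) (blockRight Z p) =
      cDiagEmbed (star (blockRight Z p)) (((Z p).re / 2 : ℝ) : ℂ) (star (star (blockRight Z p))) := by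
    rw [star_star]
  rw [hright, norm_osWeight_gram hε T hL ht, norm_osWeight_gram hε T hR' ht]
  -- abbreviations
  set r : ℕ := p + 1 + p with hr
  set s : ℕ := k - 1 - p + 1 + (k - 1 - p) with hs
  set σL : ℝ := ∑ j, (blockRevLeft Z p j).re with hσL
  set σR : ℝ := ∑ j, ((star (blockRight Z p)) j).re with hσR
  set σ : ℝ := ∑ i, (Z i).re with hσ
  have hσR' : σR = ∑ j, (blockRight Z p j).re := by
    rw [hσR]; refine Finset.sum_congr rfl fun j _ => ?_
    simp only [Pi.star_apply, Complex.star_def, Complex.conj_re]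
  have hσL0 : 0 ≤ σL := Finset.sum_nonneg fun j _ => (hL j).le
  have hσR0 : 0 ≤ σR := Finset.sum_nonneg fun j _ => (hR' j).le
  have hσ0 : 0 ≤ σ := Finset.sum_nonneg fun i _ => (hZ i).le
  have hrs : r + s = 2 * k := by rw [hr, hs]; have := p.2; omega
  have hr0 : (0 : ℝ) < r := by rw [hr]; positivity
  have hs0 : (0 : ℝ) < s := by rw [hs]; positivity
  -- the blocks partition the sum of the real parts
  have hsplit : σ = σL + (Z p).re + ∑ j, (blockRight Z p j).re := by
    rw [hσ, hσL]
    have h := sum_blocks (fun i => (Z i).re) p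
    simp only [blockRevLeft_apply, blockRight_apply] at h ⊢
    exact h
  set XL : ℝ := ε⁻¹ + (2 * σL + (Z p).re / 2) / r with hXL
  set XR : ℝ := ε⁻¹ + (2 * σR + (Z p).re / 2) / s with hXR
  have hXL0 : 0 < XL := by positivity
  have hXR0 : 0 < XR := by positivity
  set ρ : ℝ := ε⁻¹ + σ / k with hρ
  have hρ0 : 0 < ρ := by positivity
  -- the modulus of the weight at `Z`
  have hZw : ‖osWeight k ε T Z‖ ≤ (ρ ^ (k * T))⁻¹ := norm_osWeight_le hk hε T hZ
  -- AM–GM: `XL^r XR^s ≤ ρ^{2k}`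
  have hamgm : XL ^ r * XR ^ s ≤ ρ ^ (2 * k) := by
    have h1 := pow_mul_pow_le_of_amgm hXL0.le hXR0.le (r := r) (s := s) (by omega)
    rw [hrs] at h1
    refine h1.trans (pow_le_pow_left₀ (by positivity) ?_ _)
    -- `(r XL + s XR)/(2k) ≤ ρ`
    have hnum : (r : ℝ) * XL + s * XR = (r + s) * ε⁻¹ + (2 * σL + (Z p).re / 2) + (2 * σR + (Z p).re / 2) := by
      rw [hXL, hXR]; field_simp; ring
    have hrs' : ((r : ℝ) + s) = 2 * k := by exact_mod_cast hrs
    rw [hnum, hrs', hρ]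
    have hk' : (0 : ℝ) < k := by exact_mod_cast hk
    rw [div_le_iff₀ (by positivity)]
    have : (ε⁻¹ + σ / k) * (2 * k) = 2 * k * ε⁻¹ + 2 * σ := by field_simp
    rw [this, hsplit, hσR']
    linarith [hZ p]
  -- conclude
  have hTpow : (XL ^ (r * T)) * (XR ^ (s * T)) ≤ ρ ^ (k * T) * ρ ^ (k * T) := by
    rw [pow_mul, pow_mul, ← mul_pow, ← pow_add, ← two_mul, ← mul_assoc, pow_mul]
    exact pow_le_pow_left₀ (by positivity) hamgm T
  calc ‖osWeight k ε T Z‖ ^ 2 ≤ ((ρ ^ (k * T))⁻¹) ^ 2 := pow_le_pow_left₀ (norm_nonneg _) hZw 2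
    _ = (ρ ^ (k * T) * ρ ^ (k * T))⁻¹ := by rw [sq, mul_inv]
    _ ≤ ((XL ^ (r * T)) * (XR ^ (s * T)))⁻¹ := inv_anti₀ (by positivity) hTpow
    _ = (XL ^ (r * T))⁻¹ * (XR ^ (s * T))⁻¹ := mul_inv _ _

/-! ### One step of the induction (6.28)/(6.29) -/

section Step

variable {good : (k : ℕ) → (Fin (k + 1) → E) → Prop} {Sext : (k : ℕ) → (Fin (k + 1) → E) → (Fin k → ℂ) → ℂ}
  {CT ε : ℝ} {T : ℕ}

/-- **The regularised function is holomorphic on `ℂ₊ᵏ`.** [folklore] -/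
theorem differentiableOn_regFun (hhol : ∀ (k : ℕ) (c : Fin (k + 1) → E), good k c → 0 < k →
      DifferentiableOn ℂ (Sext k c) {Z | ∀ i, 0 < (Z i).re})
    (hε : 0 < ε) {k : ℕ} (hk : 0 < k) {c : Fin (k + 1) → E} (hc : good k c) :
    DifferentiableOn ℂ (regFun Sext ε T k c) {Z | ∀ i, 0 < (Z i).re} :=
  (differentiableOn_osWeight hk hε T).mul ((hhol k c hc hk).comp (differentiable_shiftVec ε).differentiableOn
    fun _ hZ i => shiftVec_re_pos hε.le hZ i)

/-- **One step of the temperedness induction (6.28) ⇒ (6.29) ⇒ (6.28)** (OS II Ch. VI.2): let `Sext`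
be a family holomorphic on `ℂ₊ᵏ` for the good labels with the level-free Schwarz inequality with
constant `CT` (`OSLabelledTower`). If the regularised functions obey `‖S_{k,ε}‖ ≤ B k` on the regions of
`c_k^{(n+1)}` for all `k` and all good labels, and `CT √(B_{2p+1} B_{2q+1}) ≤ B' k` for all positions,
then `‖S_{k,ε}‖ ≤ max (B k) (B' k)` on the regions of `c_k^{(n+2)}`. [cite: OsterwalderSchraderCMP1975, Ch. VI.2 (6.23)–(6.29)] -/
theorem tempered_step (hgood : IsOSLabelSet good) (hε : 0 < ε) (hCT : 0 ≤ CT)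
    (hhol : ∀ (k : ℕ) (c : Fin (k + 1) → E), good k c → 0 < k →
      DifferentiableOn ℂ (Sext k c) {Z | ∀ i, 0 < (Z i).re})
    (hSchw : ∀ (k : ℕ) (c : Fin (k + 1) → E), good k c → ∀ (p : Fin k) (Z : Fin k → ℂ), (∀ i, 0 < (Z i).re) →
      ∀ (x' x : ℝ) (τ : ℂ), 0 < x' → 0 < x → 0 < τ.re → (x' : ℂ) + x + τ = Z p →
        ‖Sext k c Z‖ ≤ CT *
          Real.sqrt ((Sext (p + 1 + p) (dblPos (posRevLeft c p))
            (cDiagEmbed (blockRevLeft Z p) ((2 * x' : ℝ) : ℂ) (star (blockRevLeft Z p)))).re) *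
          Real.sqrt ((Sext (k - 1 - p + 1 + (k - 1 - p)) (dblPos (posRight c p))
            (cDiagEmbed (star (blockRight Z p)) ((2 * x : ℝ) : ℂ) (blockRight Z p))).re))
    {n : ℕ} {B B' : ℕ → ℝ} (hB : ∀ k, 0 ≤ B k)
    (hlev : ∀ (k : ℕ) (c : Fin (k + 1) → E), good k c → ∀ Z ∈ argRegion (osBaseC (n + 1) k),
      ‖regFun Sext ε T k c Z‖ ≤ B k)
    (hclose : ∀ (k : ℕ) (p : Fin k), CT * Real.sqrt (B (p + 1 + p) * B (k - 1 - p + 1 + (k - 1 - p))) ≤ B' k)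
    (k : ℕ) (c : Fin (k + 1) → E) (hc : good k c) {Z : Fin k → ℂ} (hZ : Z ∈ argRegion (osBaseC (n + 2) k)) :
    ‖regFun Sext ε T k c Z‖ ≤ max (B k) (B' k) := by
  rcases Nat.eq_zero_or_pos k with rfl | hk
  · rw [show n + 2 = (n + 1) + 1 from rfl, osBaseC_succ_zero, argRegion_empty] at hZ
    exact absurd hZ (notMem_empty _)
  -- the maximum principle over the base of the step
  have hf : DifferentiableOn ℂ (regFun Sext ε T k c)
      {ζ | (∀ i, 0 < (ζ i).re) ∧ (fun i => (ζ i).arg) ∈ convexHull ℝ (stepBase n k)} :=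
    (differentiableOn_regFun hhol hε hk hc).mono fun ζ hζ => hζ.1
  have hZconv : (fun i => (Z i).arg) ∈ convexHull ℝ (stepBase n k) := by
    rw [convexHull_stepBase]; exact hZ.2
  refine norm_le_of_norm_le_on_argRegion (isOpen_stepBase n k) (zero_mem_stepBase n hk)
    (starConvex_stepBase n k) (stepBase_subset_cube n k) hf (fun ζ hζre hζB => ?_) hZ.1 hZconv
  -- the bound on the base: old region or a piece
  rcases hζB with hold | hgen
  · exact (hlev k c hc ζ ⟨hζre, hold⟩).trans (le_max_left _ _)
  rw [osGen_eq_iUnion_osPiece] at hgen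
  obtain ⟨p, hp⟩ := mem_iUnion.1 hgen
  have hζpiece : ζ ∈ argRegion (osPiece (n + 1) k p) := ⟨hζre, hp⟩
  refine le_trans ?_ ((hclose k p).trans (le_max_right _ _))
  -- the Schwarz inequality at the shifted point with the split `x' = x = ε/2 + Re ζ_p/4`
  set δ₀ : ℝ := (ζ p).re / 4 with hδ₀
  have hδ₀0 : 0 < δ₀ := by have := hζre p; positivity
  set ζ' : Fin k → ℂ := shiftVec ε ζ with hζ'
  have hζ're : ∀ i, 0 < (ζ' i).re := shiftVec_re_pos hε.le hζre
  set x : ℝ := ε / 2 + δ₀ with hx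
  have hx0 : 0 < x := by positivity
  set τ : ℂ := ζ p - ((2 * δ₀ : ℝ) : ℂ) with hτ
  have hτre : 0 < τ.re := by
    simp only [hτ, Complex.sub_re, Complex.ofReal_re, hδ₀]; linarith [hζre p]
  have hsum : (x : ℂ) + x + τ = ζ' p := by
    simp only [hζ', shiftVec_apply, hx, hτ]; push_cast; ring
  have hS := hSchw k c hc p ζ' hζ're x x τ hx0 hx0 hτre hsum
  -- the Gram points of the shifted blocks are the shifted Gram points with middle entry `2δ₀ = Re ζ_p/2`
  have h2x : ((2 * x : ℝ) : ℂ) = (((2 * δ₀ : ℝ) : ℂ)) + ε := by rw [hx]; push_cast; ring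
  set gL : Fin (p + 1 + p) → ℂ := cDiagEmbed (blockRevLeft ζ p) (((2 * δ₀ : ℝ)) : ℂ) (star (blockRevLeft ζ p))
    with hgL
  set gR : Fin (k - 1 - p + 1 + (k - 1 - p)) → ℂ :=
    cDiagEmbed (star (blockRight ζ p)) (((2 * δ₀ : ℝ)) : ℂ) (blockRight ζ p) with hgR
  have hGL' : cDiagEmbed (blockRevLeft ζ' p) ((2 * x : ℝ) : ℂ) (star (blockRevLeft ζ' p)) = shiftVec ε gL := by
    rw [hζ', blockRevLeft_shiftVec, star_shiftVec, h2x, cDiagEmbed_shiftVec]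
  have hGR' : cDiagEmbed (star (blockRight ζ' p)) ((2 * x : ℝ) : ℂ) (blockRight ζ' p) = shiftVec ε gR := by
    rw [hζ', blockRight_shiftVec, star_shiftVec, h2x, cDiagEmbed_shiftVec]
  rw [hGL', hGR'] at hS
  -- the Gram points lie in the level-`n` regions
  have hGLmem : gL ∈ argRegion (osBaseC (n + 1) (p + 1 + p)) :=
    gramLeft_mem_argRegion hζpiece (by positivity : 0 < 2 * δ₀)
  have hGRmem : gR ∈ argRegion (osBaseC (n + 1) (k - 1 - p + 1 + (k - 1 - p))) :=
    gramRight_mem_argRegion hζpiece (by positivity : 0 < 2 * δ₀)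
  have hl : good (p + 1 + p) (dblPos (posRevLeft c p)) := hgood.left k c p hc
  have hr : good (k - 1 - p + 1 + (k - 1 - p)) (dblPos (posRight c p)) := hgood.right k c p hc
  -- `Sext` at the shifted Gram points through the regularised functions of level `n`
  have hrep : ∀ {m : ℕ} (hm : 0 < m) {a : Fin (m + 1) → E} (ha : good m a) {G : Fin m → ℂ}
      (hG : G ∈ argRegion (osBaseC (n + 1) m)),
      Real.sqrt ((Sext m a (shiftVec ε G)).re) ≤ Real.sqrt (B m / ‖osWeight m ε T G‖) := by
    intro m hm a ha G hG
    have hw0 : osWeight m ε T G ≠ 0 := osWeight_ne_zero hm hε T hG.1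
    have hwpos : 0 < ‖osWeight m ε T G‖ := norm_pos_iff.2 hw0
    refine Real.sqrt_le_sqrt (((Complex.re_le_norm _).trans ?_))
    rw [le_div_iff₀ hwpos]
    have h := hlev m a ha G hG
    rw [regFun, norm_mul] at h
    linarith
  have hLb := hrep (by omega) hl hGLmem
  have hRb := hrep (by omega) hr hGRmem
  -- the comparison of the weights
  have hcmp : ‖osWeight k ε T ζ‖ ^ 2 ≤ ‖osWeight (p + 1 + p) ε T gL‖ * ‖osWeight (k - 1 - p + 1 + (k - 1 - p)) ε T gR‖ := by
    have h := norm_osWeight_sq_le hε T hζre p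
    have e : ((ζ p).re / 2 : ℝ) = 2 * δ₀ := by rw [hδ₀]; ring
    rw [e] at h
    exact h
  -- assemble
  have hwL : 0 < ‖osWeight (p + 1 + p) ε T gL‖ := norm_pos_iff.2 (osWeight_ne_zero (by omega) hε T hGLmem.1)
  have hwR : 0 < ‖osWeight (k - 1 - p + 1 + (k - 1 - p)) ε T gR‖ :=
    norm_pos_iff.2 (osWeight_ne_zero (by omega) hε T hGRmem.1)
  set wk : ℝ := ‖osWeight k ε T ζ‖ with hwk
  set wL : ℝ := ‖osWeight (p + 1 + p) ε T gL‖ with hwLdef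
  set wR : ℝ := ‖osWeight (k - 1 - p + 1 + (k - 1 - p)) ε T gR‖ with hwRdef
  set bL : ℝ := B (p + 1 + p) with hbL
  set bR : ℝ := B (k - 1 - p + 1 + (k - 1 - p)) with hbR
  have hbL0 : 0 ≤ bL := hB _
  have hbR0 : 0 ≤ bR := hB _
  have hratio : wk / Real.sqrt (wL * wR) ≤ 1 := by
    rw [div_le_one (Real.sqrt_pos.2 (mul_pos hwL hwR))]
    have hwk0 : 0 ≤ wk := by rw [hwk]; exact norm_nonneg _
    calc wk = |wk| := (abs_of_nonneg hwk0).symm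
      _ ≤ Real.sqrt (wL * wR) := Real.abs_le_sqrt hcmp
  calc ‖regFun Sext ε T k c ζ‖ = wk * ‖Sext k c ζ'‖ := by rw [regFun, norm_mul]
    _ ≤ wk * (CT * Real.sqrt (bL / wL) * Real.sqrt (bR / wR)) :=
        mul_le_mul_of_nonneg_left (hS.trans (mul_le_mul (mul_le_mul_of_nonneg_left hLb hCT) hRb
          (Real.sqrt_nonneg _) (by positivity))) (norm_nonneg _)
    _ = CT * Real.sqrt (bL * bR) * (wk / Real.sqrt (wL * wR)) := by
        rw [Real.sqrt_div' _ (le_of_lt hwL), Real.sqrt_div' _ (le_of_lt hwR), Real.sqrt_mul hbL0,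
          Real.sqrt_mul hwL.le]
        field_simp
    _ ≤ CT * Real.sqrt (bL * bR) * 1 := mul_le_mul_of_nonneg_left hratio (by positivity)
    _ = CT * Real.sqrt (bL * bR) := mul_one _

end Step

end Literature.MathematicalPhysics.QuantumFieldTheory.OSEnvelope
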